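import Summits.Parity.GeneralizedHardyLittlewood.Theorems.LeeYangFibresRelativeDimOneTypeDefs
import HarnessLib

/-!
# Type-class moments: the multilinear expansion over a cell (crux stmt-Parity-14113
`LeeYangFibres.RelativeDimOne`, line gallagher-backwards-split, RESHAPED type-conditioned split; aux for stub
`stub_typeClassMoments`, part B)

Pure finite bookkeeping, no primes. Data: a finite set `cell` of residue vectors `c ∈ [0,q)^t`, nonnegative
class functions `D_i : [0,q) → ℝ` (think `D_i(r) = ψ(hi_i; q, r) − ψ(lo_i; q, r)`), main terms `M_i`
(think `(X_i+1)/φ(q)`), sup bounds `B_i > 0` (Brun–Titchmarsh) with `M_i ≤ B_i`, a junk level `J₀` bounding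
`D_i` on the non-units, and three small parameters: `ρP` (PNT: `|Σ_{r unit} (D_i(r) − M_i)| ≤ ρP φ B_i`), `ρV`
(class variance: `Σ_{r unit} (D_i(r) − M_i)² ≤ ρV φ B_i²`) and `ρJ` (`J₀ ≤ ρJ B_i`). The one structural input is
the COLLAPSE IDENTITY of the all-unit part `cellU` of the cell (part A, `TCM.sum_cellU_apply`):
`Σ_{c ∈ cellU} F(c_i) = (#cellU/φ) Σ_{r unit} F(r)`.

Conclusion (`expansion_bound`, registered hook `expansionBoundHook`):
`|Σ_{c ∈ cell} ∏_i D_i(c_i) − ∏_i M_i · #cellU| ≤ 2^t (ρP + ρV) ∏_i B_i · #cellU + 2^t ρJ ∏_i B_i · #cell`.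

Proof: peel off the non-unit coordinates (every `S ≠ ∅` term carries a factor `J₀ ≤ ρJ B_{i₀}`); on `cellU` expand
`∏_i (M_i + g_i(c_i))`; one deviation `J = {i}` collapses to `(#cellU/φ) Σ_{r unit} g_i(r)` (PNT input); two or more
deviations `i ≠ k ∈ J` are bounded through `|g_i g_k| ≤ (B_k/2B_i) g_i² + (B_i/2B_k) g_k²` (class variance).
-/

noncomputable section

open scoped BigOperators Classical
open Finset

namespace Summit.Parity.GeneralizedHardyLittlewood.Cruxes.RelativeDimOne.TypeSplit

namespace TCM

variable {t : ℕ}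

/-! ### Unit / non-unit parts -/

/-- `Dn + Du = D`: the non-unit part `Dn(r) = [gcd(r,q) ≠ 1] D(r)` plus the unit part
`Du(r) = [gcd(r,q) = 1] D(r)` (both written as `if`s; no definitions are introduced). -/
theorem Dn_add_Du (q : ℕ) (D : ℕ → ℝ) (r : ℕ) :
    (if r.Coprime q then 0 else D r) + (if r.Coprime q then D r else 0) = D r := by
  split_ifs <;> simp

/-- An elementary inequality: `|x| |y| ≤ (α/2) x² + y²/(2α)` for `α > 0`. -/
theorem abs_mul_abs_le {α : ℝ} (hα : 0 < α) (x y : ℝ) :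
    |x| * |y| ≤ α / 2 * x ^ 2 + 1 / (2 * α) * y ^ 2 := by
  have h1 : 0 ≤ (α * |x| - |y|) ^ 2 := sq_nonneg _
  have hx : |x| ^ 2 = x ^ 2 := sq_abs x
  have hy : |y| ^ 2 = y ^ 2 := sq_abs y
  have h2 : 2 * α * (|x| * |y|) ≤ α ^ 2 * x ^ 2 + y ^ 2 := by nlinarith
  have h3 : α / 2 * x ^ 2 + 1 / (2 * α) * y ^ 2 = (α ^ 2 * x ^ 2 + y ^ 2) / (2 * α) := by
    field_simp
  rw [h3, le_div_iff₀ (by positivity)]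
  linarith

/-! ### Level 1: peeling off the non-unit coordinates -/

/-- `∏_i Du_i(c_i)` is `∏_i D_i(c_i)` on all-unit vectors and `0` otherwise. -/
theorem prod_Du_eq (q : ℕ) (D : Fin t → ℕ → ℝ) (c : Fin t → ℕ) :
    ∏ i, (if (c i).Coprime q then D i (c i) else 0) =
      if ∀ j, (c j).Coprime q then ∏ i, D i (c i) else 0 := by
  split_ifs with h
  · refine Finset.prod_congr rfl fun i _ => ?_
    simp [h i]
  · push Not at h
    obtain ⟨j, hj⟩ := h
    exact Finset.prod_eq_zero (Finset.mem_univ j) (by simp [hj])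

/-- LEVEL 1 EXPANSION: `Σ_{cell} ∏ D = Σ_{cellU} ∏ D + Σ_{S ≠ ∅} Σ_{cell} ∏_{S} Dn ∏_{Sᶜ} Du`. -/
theorem level1_expansion (q : ℕ) (cell : Finset (Fin t → ℕ)) (D : Fin t → ℕ → ℝ) :
    ∑ c ∈ cell, ∏ i, D i (c i) =
      ∑ c ∈ cell.filter (fun c => ∀ j, (c j).Coprime q), ∏ i, D i (c i) +
      ∑ S ∈ ((univ : Finset (Fin t)).powerset).erase ∅,
        ∑ c ∈ cell, (∏ i ∈ S, (if (c i).Coprime q then 0 else D i (c i))) * ∏ i ∈ univ \ S, (if (c i).Coprime q then D i (c i) else 0) := by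
  have h1 : ∀ c ∈ cell, ∏ i, D i (c i) =
      ∑ S ∈ (univ : Finset (Fin t)).powerset,
        (∏ i ∈ S, (if (c i).Coprime q then 0 else D i (c i))) * ∏ i ∈ univ \ S, (if (c i).Coprime q then D i (c i) else 0) := by
    intro c _
    rw [← Finset.prod_add]
    exact Finset.prod_congr rfl fun i _ => (Dn_add_Du q (D i) (c i)).symm
  rw [Finset.sum_congr rfl h1, Finset.sum_comm,
    ← Finset.add_sum_erase _ _ (Finset.empty_mem_powerset _)]
  congr 1
  rw [Finset.sum_filter]
  refine Finset.sum_congr rfl fun c _ => ?_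
  rw [Finset.prod_empty, one_mul, Finset.sdiff_empty, prod_Du_eq]

/-- LEVEL 1 BOUND: each term with a non-unit coordinate is `≥ 0` and `≤ #cell · ρJ ∏ B`. -/
theorem level1_junk_bound (q : ℕ) (cell : Finset (Fin t → ℕ)) (D : Fin t → ℕ → ℝ) (B : Fin t → ℝ)
    (J₀ ρJ : ℝ) (hJ0 : 0 ≤ J₀) (hρJ : 0 ≤ ρJ)
    (hcell : ∀ c ∈ cell, ∀ i, c i < q) (hD0 : ∀ i r, 0 ≤ D i r)
    (hB : ∀ i r, r < q → r.Coprime q → D i r ≤ B i)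
    (hJ : ∀ i r, r < q → ¬ r.Coprime q → D i r ≤ J₀)
    (hJB : ∀ i, J₀ ≤ B i) (hJρ : ∀ i, J₀ ≤ ρJ * B i)
    (S : Finset (Fin t)) (hS : S.Nonempty) :
    0 ≤ ∑ c ∈ cell, (∏ i ∈ S, (if (c i).Coprime q then 0 else D i (c i))) * ∏ i ∈ univ \ S, (if (c i).Coprime q then D i (c i) else 0) ∧
    ∑ c ∈ cell, (∏ i ∈ S, (if (c i).Coprime q then 0 else D i (c i))) * ∏ i ∈ univ \ S, (if (c i).Coprime q then D i (c i) else 0) ≤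
      cell.card * (ρJ * ∏ i, B i) := by
  have hB0 : ∀ i, 0 ≤ B i := fun i => hJ0.trans (hJB i)
  have hDn0 : ∀ i r, 0 ≤ (if r.Coprime q then 0 else D i r) := fun i r => by
    split_ifs; exacts [le_rfl, hD0 i r]
  have hDu0 : ∀ i r, 0 ≤ (if r.Coprime q then D i r else 0) := fun i r => by
    split_ifs; exacts [hD0 i r, le_rfl]
  have hDnJ : ∀ i r, r < q → (if r.Coprime q then 0 else D i r) ≤ J₀ := fun i r hr => by
    split_ifs with h; exacts [hJ0, hJ i r hr h]
  have hDuB : ∀ i r, r < q → (if r.Coprime q then D i r else 0) ≤ B i := fun i r hr => by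
    split_ifs with h; exacts [hB i r hr h, hB0 i]
  obtain ⟨i₀, hi₀⟩ := hS
  have hpt : ∀ c ∈ cell,
      0 ≤ (∏ i ∈ S, (if (c i).Coprime q then 0 else D i (c i))) * ∏ i ∈ univ \ S, (if (c i).Coprime q then D i (c i) else 0) ∧
      (∏ i ∈ S, (if (c i).Coprime q then 0 else D i (c i))) * ∏ i ∈ univ \ S, (if (c i).Coprime q then D i (c i) else 0) ≤ ρJ * ∏ i, B i := by
    intro c hc
    have hcq := hcell c hc
    refine ⟨mul_nonneg (Finset.prod_nonneg fun i _ => hDn0 i _)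
      (Finset.prod_nonneg fun i _ => hDu0 i _), ?_⟩
    have hρB : 0 ≤ ρJ * B i₀ := hJ0.trans (hJρ i₀)
    -- the non-unit block
    have h1 : ∏ i ∈ S, (if (c i).Coprime q then 0 else D i (c i)) ≤ ρJ * ∏ i ∈ S, B i := by
      rw [← Finset.mul_prod_erase S (fun i => (if (c i).Coprime q then 0 else D i (c i))) hi₀,
        ← Finset.mul_prod_erase S B hi₀, ← mul_assoc]
      refine mul_le_mul ((hDnJ i₀ _ (hcq i₀)).trans (hJρ i₀)) ?_
        (Finset.prod_nonneg fun i _ => hDn0 i _) hρB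
      exact Finset.prod_le_prod (fun i _ => hDn0 i _)
        fun i _ => (hDnJ i _ (hcq i)).trans (hJB i)
    -- the unit block
    have h2 : ∏ i ∈ univ \ S, (if (c i).Coprime q then D i (c i) else 0) ≤ ∏ i ∈ univ \ S, B i :=
      Finset.prod_le_prod (fun i _ => hDu0 i _) fun i _ => hDuB i _ (hcq i)
    have h3 : (ρJ * ∏ i ∈ S, B i) * ∏ i ∈ univ \ S, B i = ρJ * ∏ i, B i := by
      rw [mul_assoc, ← Finset.compl_eq_univ_sdiff, Finset.prod_mul_prod_compl]
    rw [← h3]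
    exact mul_le_mul h1 h2 (Finset.prod_nonneg fun i _ => hDu0 i _)
      (mul_nonneg hρJ (Finset.prod_nonneg fun i _ => hB0 i))
  refine ⟨Finset.sum_nonneg fun c hc => (hpt c hc).1, ?_⟩
  have := Finset.sum_le_card_nsmul cell _ _ fun c hc => (hpt c hc).2
  rwa [nsmul_eq_mul] at this

/-! ### Level 2: the expansion on the all-unit part -/

/-- LEVEL 2 EXPANSION on the all-unit part `cellU`:
`Σ_{cellU} ∏ D = ∏ M · #cellU + Σ_{J ≠ ∅} ∏_{i ∉ J} M_i Σ_{cellU} ∏_{i∈J} (D_i(c_i) − M_i)`. -/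
theorem level2_expansion (cellU : Finset (Fin t → ℕ)) (D : Fin t → ℕ → ℝ) (M : Fin t → ℝ) :
    ∑ c ∈ cellU, ∏ i, D i (c i) = (∏ i, M i) * cellU.card +
      ∑ J ∈ ((univ : Finset (Fin t)).powerset).erase ∅,
        (∏ i ∈ univ \ J, M i) * ∑ c ∈ cellU, ∏ i ∈ J, (D i (c i) - M i) := by
  have h1 : ∀ c ∈ cellU, ∏ i, D i (c i) =
      ∑ J ∈ (univ : Finset (Fin t)).powerset,
        (∏ i ∈ J, (D i (c i) - M i)) * ∏ i ∈ univ \ J, M i := by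
    intro c _
    rw [← Finset.prod_add]
    exact Finset.prod_congr rfl fun i _ => by ring
  rw [Finset.sum_congr rfl h1, Finset.sum_comm,
    ← Finset.add_sum_erase _ _ (Finset.empty_mem_powerset _)]
  congr 1
  · simp only [Finset.prod_empty, one_mul, Finset.sdiff_empty]
    rw [Finset.sum_const, nsmul_eq_mul]
    ring
  · refine Finset.sum_congr rfl fun J _ => ?_
    rw [Finset.mul_sum]
    refine Finset.sum_congr rfl fun c _ => ?_
    ring

/-- ONE DEVIATION (`J = {i}`): the term collapses to `(#cellU/φ) Σ_{r unit} (D_i(r) − M_i)` and is bounded by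
the PNT input: `≤ ρP · #cellU · ∏ B`. -/
theorem level2_single (q : ℕ) (cellU : Finset (Fin t → ℕ)) (D : Fin t → ℕ → ℝ) (M B : Fin t → ℝ)
    (φ ρP : ℝ) (hφ : 0 < φ)
    (hM : ∀ i, 0 ≤ M i ∧ M i ≤ B i)
    (hP : ∀ i, |∑ r ∈ (range q).filter (fun r => r.Coprime q), (D i r - M i)| ≤ ρP * φ * B i)
    (hfib : ∀ i (F : ℕ → ℝ), ∑ c ∈ cellU, F (c i) =
        (cellU.card : ℝ) / φ * ∑ r ∈ (range q).filter (fun r => r.Coprime q), F r)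
    (i : Fin t) :
    |(∏ j ∈ univ \ {i}, M j) * ∑ c ∈ cellU, ∏ j ∈ ({i} : Finset (Fin t)), (D j (c j) - M j)| ≤
      ρP * cellU.card * ∏ j, B j := by
  have hB0 : ∀ j, 0 ≤ B j := fun j => (hM j).1.trans (hM j).2
  have h1 : ∑ c ∈ cellU, ∏ j ∈ ({i} : Finset (Fin t)), (D j (c j) - M j) =
      (cellU.card : ℝ) / φ * ∑ r ∈ (range q).filter (fun r => r.Coprime q), (D i r - M i) := by
    simp only [Finset.prod_singleton]
    exact hfib i (fun r => D i r - M i)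
  rw [h1, abs_mul, Finset.abs_prod]
  have hM' : ∏ j ∈ univ \ {i}, |M j| ≤ ∏ j ∈ univ \ {i}, B j :=
    Finset.prod_le_prod (fun j _ => abs_nonneg _) fun j _ => by
      rw [abs_of_nonneg (hM j).1]; exact (hM j).2
  have h2 : |(cellU.card : ℝ) / φ * ∑ r ∈ (range q).filter (fun r => r.Coprime q), (D i r - M i)| ≤
      (cellU.card : ℝ) / φ * (ρP * φ * B i) := by
    rw [abs_mul, abs_of_nonneg (by positivity)]
    exact mul_le_mul_of_nonneg_left (hP i) (by positivity)
  have h3 : (cellU.card : ℝ) / φ * (ρP * φ * B i) = ρP * cellU.card * B i := by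
    field_simp
  calc (∏ j ∈ univ \ {i}, |M j|) *
        |(cellU.card : ℝ) / φ * ∑ r ∈ (range q).filter (fun r => r.Coprime q), (D i r - M i)|
      ≤ (∏ j ∈ univ \ {i}, B j) * ((cellU.card : ℝ) / φ * (ρP * φ * B i)) :=
        mul_le_mul hM' h2 (abs_nonneg _) (Finset.prod_nonneg fun j _ => hB0 j)
    _ = ρP * cellU.card * ((∏ j ∈ univ \ {i}, B j) * B i) := by rw [h3]; ring
    _ = ρP * cellU.card * ∏ j, B j := by
        rw [Finset.sdiff_singleton_eq_erase, Finset.prod_erase_mul _ _ (Finset.mem_univ i)]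

/-- Algebra: the two collapsed squares add up to `ρ K B_i B_k`. -/
theorem alg_one {K φ ρ Bi Bk : ℝ} (hφ : φ ≠ 0) (hi : Bi ≠ 0) (hk : Bk ≠ 0) :
    Bk / (2 * Bi) * (K / φ * (ρ * φ * Bi ^ 2)) + Bi / (2 * Bk) * (K / φ * (ρ * φ * Bk ^ 2)) =
      ρ * K * (Bi * Bk) := by
  field_simp
  ring

/-- TWO OR MORE DEVIATIONS (`i ≠ k ∈ J`): bounded by the class variance at `i` and `k`:
`≤ ρV · #cellU · ∏ B`. -/
theorem level2_double (q : ℕ) (cellU : Finset (Fin t → ℕ)) (D : Fin t → ℕ → ℝ) (M B : Fin t → ℝ)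
    (φ ρV : ℝ) (hφ : 0 < φ)
    (hcellU : ∀ c ∈ cellU, ∀ j, c j < q ∧ (c j).Coprime q)
    (hD0 : ∀ i r, 0 ≤ D i r) (hB0 : ∀ i, 0 < B i) (hM : ∀ i, 0 ≤ M i ∧ M i ≤ B i)
    (hB : ∀ i r, r < q → r.Coprime q → D i r ≤ B i)
    (hV : ∀ i, ∑ r ∈ (range q).filter (fun r => r.Coprime q), (D i r - M i) ^ 2 ≤ ρV * φ * B i ^ 2)
    (hfib : ∀ i (F : ℕ → ℝ), ∑ c ∈ cellU, F (c i) =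
        (cellU.card : ℝ) / φ * ∑ r ∈ (range q).filter (fun r => r.Coprime q), F r)
    (J : Finset (Fin t)) {i k : Fin t} (hi : i ∈ J) (hk : k ∈ J) (hik : i ≠ k) :
    |(∏ j ∈ univ \ J, M j) * ∑ c ∈ cellU, ∏ j ∈ J, (D j (c j) - M j)| ≤
      ρV * cellU.card * ∏ j, B j := by
  set g : Fin t → ℕ → ℝ := fun j r => D j r - M j with hg
  have hfold : ∀ j r, D j r - M j = g j r := fun j r => rfl
  simp only [hfold]
  -- `|g_j(r)| ≤ B_j` on units
  have hgB : ∀ j r, r < q → r.Coprime q → |g j r| ≤ B j := by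
    intro j r hr hrq
    rw [← hfold, abs_sub_le_iff]
    constructor
    · linarith [hB j r hr hrq, (hM j).1]
    · linarith [hD0 j r, (hM j).2]
  have hk' : k ∈ J.erase i := Finset.mem_erase.2 ⟨hik.symm, hk⟩
  -- pointwise bound on `cellU`
  have hpt : ∀ c ∈ cellU, |∏ j ∈ J, g j (c j)| ≤
      (∏ j ∈ (J.erase i).erase k, B j) *
        (B k / (2 * B i) * g i (c i) ^ 2 + B i / (2 * B k) * g k (c k) ^ 2) := by
    intro c hc
    rw [Finset.abs_prod, ← Finset.mul_prod_erase J _ hi, ← Finset.mul_prod_erase (J.erase i) _ hk']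
    have h1 : ∏ j ∈ (J.erase i).erase k, |g j (c j)| ≤ ∏ j ∈ (J.erase i).erase k, B j :=
      Finset.prod_le_prod (fun j _ => abs_nonneg _)
        fun j _ => hgB j _ (hcellU c hc j).1 (hcellU c hc j).2
    have h2 : |g i (c i)| * |g k (c k)| ≤
        B k / (2 * B i) * g i (c i) ^ 2 + B i / (2 * B k) * g k (c k) ^ 2 := by
      have h := abs_mul_abs_le (div_pos (hB0 k) (hB0 i)) (g i (c i)) (g k (c k))
      have e1 : B k / B i / 2 = B k / (2 * B i) := by ring
      have e2 : 1 / (2 * (B k / B i)) = B i / (2 * B k) := by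
        rw [← mul_div_assoc, one_div_div]
      rwa [e1, e2] at h
    calc |g i (c i)| * (|g k (c k)| * ∏ j ∈ (J.erase i).erase k, |g j (c j)|)
        = (∏ j ∈ (J.erase i).erase k, |g j (c j)|) * (|g i (c i)| * |g k (c k)|) := by ring
      _ ≤ (∏ j ∈ (J.erase i).erase k, B j) *
          (B k / (2 * B i) * g i (c i) ^ 2 + B i / (2 * B k) * g k (c k) ^ 2) :=
        mul_le_mul h1 h2 (mul_nonneg (abs_nonneg _) (abs_nonneg _))
          (Finset.prod_nonneg fun j _ => (hB0 j).le)
  -- the squares collapse to the class variance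
  have hsq : ∀ j, ∑ c ∈ cellU, g j (c j) ^ 2 ≤ (cellU.card : ℝ) / φ * (ρV * φ * B j ^ 2) := by
    intro j
    rw [hfib j (fun r => g j r ^ 2)]
    exact mul_le_mul_of_nonneg_left (hV j) (div_nonneg (Nat.cast_nonneg _) hφ.le)
  have hsum : |∑ c ∈ cellU, ∏ j ∈ J, g j (c j)| ≤
      (∏ j ∈ (J.erase i).erase k, B j) * (ρV * cellU.card * (B i * B k)) := by
    have hki : 0 ≤ B k / (2 * B i) := (div_pos (hB0 k) (mul_pos two_pos (hB0 i))).le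
    have hik' : 0 ≤ B i / (2 * B k) := (div_pos (hB0 i) (mul_pos two_pos (hB0 k))).le
    calc |∑ c ∈ cellU, ∏ j ∈ J, g j (c j)| ≤ ∑ c ∈ cellU, |∏ j ∈ J, g j (c j)| :=
          Finset.abs_sum_le_sum_abs _ _
      _ ≤ ∑ c ∈ cellU, (∏ j ∈ (J.erase i).erase k, B j) *
            (B k / (2 * B i) * g i (c i) ^ 2 + B i / (2 * B k) * g k (c k) ^ 2) :=
          Finset.sum_le_sum hpt
      _ = (∏ j ∈ (J.erase i).erase k, B j) *
            (B k / (2 * B i) * ∑ c ∈ cellU, g i (c i) ^ 2 +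
              B i / (2 * B k) * ∑ c ∈ cellU, g k (c k) ^ 2) := by
          rw [← Finset.mul_sum, Finset.sum_add_distrib, Finset.mul_sum, Finset.mul_sum]
      _ ≤ (∏ j ∈ (J.erase i).erase k, B j) *
            (B k / (2 * B i) * ((cellU.card : ℝ) / φ * (ρV * φ * B i ^ 2)) +
              B i / (2 * B k) * ((cellU.card : ℝ) / φ * (ρV * φ * B k ^ 2))) := by
          apply mul_le_mul_of_nonneg_left _ (Finset.prod_nonneg fun j _ => (hB0 j).le)
          exact add_le_add (mul_le_mul_of_nonneg_left (hsq i) hki)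
            (mul_le_mul_of_nonneg_left (hsq k) hik')
      _ = (∏ j ∈ (J.erase i).erase k, B j) * (ρV * cellU.card * (B i * B k)) := by
          rw [alg_one hφ.ne' (hB0 i).ne' (hB0 k).ne']
  -- assemble with the `M`-block
  have hM' : |∏ j ∈ univ \ J, M j| ≤ ∏ j ∈ univ \ J, B j := by
    rw [Finset.abs_prod]
    exact Finset.prod_le_prod (fun j _ => abs_nonneg _) fun j _ => by
      rw [abs_of_nonneg (hM j).1]; exact (hM j).2
  have hprod : (∏ j ∈ univ \ J, B j) * ((∏ j ∈ (J.erase i).erase k, B j) * (B i * B k)) =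
      ∏ j, B j := by
    have e1 : (∏ j ∈ (J.erase i).erase k, B j) * (B i * B k) = ∏ j ∈ J, B j := by
      rw [mul_comm (B i) (B k), ← mul_assoc, Finset.prod_erase_mul _ _ hk',
        Finset.prod_erase_mul _ _ hi]
    rw [e1, ← Finset.compl_eq_univ_sdiff, mul_comm, Finset.prod_mul_prod_compl]
  rw [abs_mul]
  calc |∏ j ∈ univ \ J, M j| * |∑ c ∈ cellU, ∏ j ∈ J, g j (c j)|
      ≤ (∏ j ∈ univ \ J, B j) *
          ((∏ j ∈ (J.erase i).erase k, B j) * (ρV * cellU.card * (B i * B k))) :=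
        mul_le_mul hM' hsum (abs_nonneg _) (Finset.prod_nonneg fun j _ => (hB0 j).le)
    _ = ρV * cellU.card *
          ((∏ j ∈ univ \ J, B j) * ((∏ j ∈ (J.erase i).erase k, B j) * (B i * B k))) := by ring
    _ = ρV * cellU.card * ∏ j, B j := by rw [hprod]

/-- LEVEL 2 BOUND: every term with `J ≠ ∅` is `≤ (ρP + ρV) · #cellU · ∏ B` in absolute value. -/
theorem level2_term_bound (q : ℕ) (cellU : Finset (Fin t → ℕ)) (D : Fin t → ℕ → ℝ) (M B : Fin t → ℝ)
    (φ ρP ρV : ℝ) (hφ : 0 < φ) (hρP : 0 ≤ ρP) (hρV : 0 ≤ ρV)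
    (hcellU : ∀ c ∈ cellU, ∀ j, c j < q ∧ (c j).Coprime q)
    (hD0 : ∀ i r, 0 ≤ D i r) (hB0 : ∀ i, 0 < B i) (hM : ∀ i, 0 ≤ M i ∧ M i ≤ B i)
    (hB : ∀ i r, r < q → r.Coprime q → D i r ≤ B i)
    (hP : ∀ i, |∑ r ∈ (range q).filter (fun r => r.Coprime q), (D i r - M i)| ≤ ρP * φ * B i)
    (hV : ∀ i, ∑ r ∈ (range q).filter (fun r => r.Coprime q), (D i r - M i) ^ 2 ≤ ρV * φ * B i ^ 2)
    (hfib : ∀ i (F : ℕ → ℝ), ∑ c ∈ cellU, F (c i) =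
        (cellU.card : ℝ) / φ * ∑ r ∈ (range q).filter (fun r => r.Coprime q), F r)
    (J : Finset (Fin t)) (hJ : J.Nonempty) :
    |(∏ j ∈ univ \ J, M j) * ∑ c ∈ cellU, ∏ j ∈ J, (D j (c j) - M j)| ≤
      (ρP + ρV) * cellU.card * ∏ j, B j := by
  have hKB : 0 ≤ (cellU.card : ℝ) * ∏ j, B j :=
    mul_nonneg (Nat.cast_nonneg _) (Finset.prod_nonneg fun j _ => (hB0 j).le)
  obtain ⟨i, hi⟩ := hJ
  by_cases h : ∃ k ∈ J, k ≠ i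
  · obtain ⟨k, hk, hki⟩ := h
    calc _ ≤ ρV * cellU.card * ∏ j, B j :=
          level2_double q cellU D M B φ ρV hφ hcellU hD0 hB0 hM hB hV hfib J hi hk hki.symm
      _ ≤ (ρP + ρV) * cellU.card * ∏ j, B j := by nlinarith
  · push Not at h
    have hJ' : J = {i} := by
      ext j
      simp only [Finset.mem_singleton]
      exact ⟨fun hj => h j hj, fun hj => hj ▸ hi⟩
    rw [hJ']
    calc _ ≤ ρP * cellU.card * ∏ j, B j := level2_single q cellU D M B φ ρP hφ hM hP hfib i
      _ ≤ (ρP + ρV) * cellU.card * ∏ j, B j := by nlinarith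

/-! ### The expansion bound -/

/-- **The expansion bound over a type cell.** See the file header. -/
theorem expansion_bound (q : ℕ) (cell : Finset (Fin t → ℕ)) (D : Fin t → ℕ → ℝ) (M B : Fin t → ℝ)
    (φ ρP ρV ρJ J₀ : ℝ) (hφ : 0 < φ) (hρP : 0 ≤ ρP) (hρV : 0 ≤ ρV) (hρJ : 0 ≤ ρJ) (hJ0 : 0 ≤ J₀)
    (hcell : ∀ c ∈ cell, ∀ i, c i < q)
    (hD0 : ∀ i r, 0 ≤ D i r) (hB0 : ∀ i, 0 < B i) (hM : ∀ i, 0 ≤ M i ∧ M i ≤ B i)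
    (hB : ∀ i r, r < q → r.Coprime q → D i r ≤ B i)
    (hJ : ∀ i r, r < q → ¬ r.Coprime q → D i r ≤ J₀)
    (hJB : ∀ i, J₀ ≤ B i) (hJρ : ∀ i, J₀ ≤ ρJ * B i)
    (hP : ∀ i, |∑ r ∈ (range q).filter (fun r => r.Coprime q), (D i r - M i)| ≤ ρP * φ * B i)
    (hV : ∀ i, ∑ r ∈ (range q).filter (fun r => r.Coprime q), (D i r - M i) ^ 2 ≤ ρV * φ * B i ^ 2)
    (hfib : ∀ i (F : ℕ → ℝ), ∑ c ∈ cell.filter (fun c => ∀ j, (c j).Coprime q), F (c i) =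
        ((cell.filter (fun c => ∀ j, (c j).Coprime q)).card : ℝ) / φ *
          ∑ r ∈ (range q).filter (fun r => r.Coprime q), F r) :
    |∑ c ∈ cell, ∏ i, D i (c i) - (∏ i, M i) * (cell.filter (fun c => ∀ j, (c j).Coprime q)).card| ≤
      2 ^ t * (ρP + ρV) * (∏ i, B i) * (cell.filter (fun c => ∀ j, (c j).Coprime q)).card +
      2 ^ t * ρJ * (∏ i, B i) * cell.card := by
  set cellU := cell.filter (fun c => ∀ j, (c j).Coprime q) with hcellU_def
  have hcellU : ∀ c ∈ cellU, ∀ j, c j < q ∧ (c j).Coprime q := by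
    intro c hc j
    rw [hcellU_def, Finset.mem_filter] at hc
    exact ⟨hcell c hc.1 j, hc.2 j⟩
  have hPB : 0 ≤ ∏ i, B i := Finset.prod_nonneg fun i _ => (hB0 i).le
  have hcard : ((((univ : Finset (Fin t)).powerset).erase ∅).card : ℝ) ≤ 2 ^ t := by
    have h1 := Finset.card_erase_le (s := (univ : Finset (Fin t)).powerset) (a := ∅)
    rw [Finset.card_powerset, Finset.card_univ, Fintype.card_fin] at h1
    exact_mod_cast h1
  rw [level1_expansion q cell D, level2_expansion cellU D M]
  have e : (∏ i, M i) * (cellU.card : ℝ) +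
      ∑ J ∈ ((univ : Finset (Fin t)).powerset).erase ∅,
        (∏ i ∈ univ \ J, M i) * ∑ c ∈ cellU, ∏ i ∈ J, (D i (c i) - M i) +
      ∑ S ∈ ((univ : Finset (Fin t)).powerset).erase ∅,
        ∑ c ∈ cell, (∏ i ∈ S, (if (c i).Coprime q then 0 else D i (c i))) * ∏ i ∈ univ \ S, (if (c i).Coprime q then D i (c i) else 0) -
      (∏ i, M i) * (cellU.card : ℝ) =
      ∑ J ∈ ((univ : Finset (Fin t)).powerset).erase ∅,
        (∏ i ∈ univ \ J, M i) * ∑ c ∈ cellU, ∏ i ∈ J, (D i (c i) - M i) +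
      ∑ S ∈ ((univ : Finset (Fin t)).powerset).erase ∅,
        ∑ c ∈ cell, (∏ i ∈ S, (if (c i).Coprime q then 0 else D i (c i))) * ∏ i ∈ univ \ S, (if (c i).Coprime q then D i (c i) else 0) := by ring
  rw [e]
  refine (abs_add_le _ _).trans (add_le_add ?_ ?_)
  · calc _ ≤ ∑ J ∈ ((univ : Finset (Fin t)).powerset).erase ∅,
          |(∏ i ∈ univ \ J, M i) * ∑ c ∈ cellU, ∏ i ∈ J, (D i (c i) - M i)| :=
          Finset.abs_sum_le_sum_abs _ _
      _ ≤ (((univ : Finset (Fin t)).powerset).erase ∅).card • ((ρP + ρV) * cellU.card * ∏ j, B j) := by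
          refine Finset.sum_le_card_nsmul _ _ _ fun J hJ => ?_
          exact level2_term_bound q cellU D M B φ ρP ρV hφ hρP hρV hcellU hD0 hB0 hM hB hP hV hfib J
            (Finset.nonempty_of_ne_empty (Finset.mem_erase.1 hJ).1)
      _ ≤ 2 ^ t * (ρP + ρV) * (∏ i, B i) * cellU.card := by
          rw [nsmul_eq_mul]
          have h0 : 0 ≤ (ρP + ρV) * cellU.card * ∏ j, B j := by positivity
          nlinarith
  · have hnn : ∀ S ∈ ((univ : Finset (Fin t)).powerset).erase ∅,
        0 ≤ ∑ c ∈ cell, (∏ i ∈ S, (if (c i).Coprime q then 0 else D i (c i))) * ∏ i ∈ univ \ S, (if (c i).Coprime q then D i (c i) else 0) ∧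
        ∑ c ∈ cell, (∏ i ∈ S, (if (c i).Coprime q then 0 else D i (c i))) * ∏ i ∈ univ \ S, (if (c i).Coprime q then D i (c i) else 0) ≤
          cell.card * (ρJ * ∏ i, B i) :=
      fun S hS => level1_junk_bound q cell D B J₀ ρJ hJ0 hρJ hcell hD0 hB hJ hJB hJρ S
        (Finset.nonempty_of_ne_empty (Finset.mem_erase.1 hS).1)
    rw [abs_of_nonneg (Finset.sum_nonneg fun S hS => (hnn S hS).1)]
    calc _ ≤ (((univ : Finset (Fin t)).powerset).erase ∅).card • ((cell.card : ℝ) * (ρJ * ∏ i, B i)) :=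
          Finset.sum_le_card_nsmul _ _ _ fun S hS => (hnn S hS).2
      _ ≤ 2 ^ t * ρJ * (∏ i, B i) * cell.card := by
          rw [nsmul_eq_mul]
          have h0 : 0 ≤ (cell.card : ℝ) * (ρJ * ∏ i, B i) := by positivity
          nlinarith

/-- HOOK (registered, ∀-form of `expansion_bound`): the expansion bound over a type cell. -/
theorem expansionBoundHook : ∀ {t : ℕ} (q : ℕ) (cell : Finset (Fin t → ℕ)) (D : Fin t → ℕ → ℝ) (M B : Fin t → ℝ) (φ ρP ρV ρJ J₀ : ℝ), 0 < φ → 0 ≤ ρP → 0 ≤ ρV → 0 ≤ ρJ → 0 ≤ J₀ → (∀ c ∈ cell, ∀ i, c i < q) → (∀ i r, 0 ≤ D i r) → (∀ i, 0 < B i) → (∀ i, 0 ≤ M i ∧ M i ≤ B i) → (∀ i r, r < q → r.Coprime q → D i r ≤ B i) → (∀ i r, r < q → ¬ r.Coprime q → D i r ≤ J₀) → (∀ i, J₀ ≤ B i) → (∀ i, J₀ ≤ ρJ * B i) → (∀ i, |∑ r ∈ (Finset.range q).filter (fun r => r.Coprime q), (D i r - M i)| ≤ ρP * φ * B i) → (∀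 i, ∑ r ∈ (Finset.range q).filter (fun r => r.Coprime q), (D i r - M i) ^ 2 ≤ ρV * φ * B i ^ 2) → (∀ i (F : ℕ → ℝ), ∑ c ∈ cell.filter (fun c => ∀ j, (c j).Coprime q), F (c i) = ((cell.filter (fun c => ∀ j, (c j).Coprime q)).card : ℝ) / φ * ∑ r ∈ (Finset.range q).filter (fun r => r.Coprime q), F r) → |∑ c ∈ cell, ∏ i, D i (c i) - (∏ i, M i) * (cell.filter (fun c => ∀ j, (c j).Coprime q)).card| ≤ 2 ^ t * (ρP + ρV) * (∏ i, B i) * (cell.filter (fun c => ∀ j, (c j).Coprime q)).card + 2 ^ t * ρJ * (∏ i, B i) * cell.card :=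
  fun q cell D M B φ ρP ρV ρJ J₀ => expansion_bound q cell D M B φ ρP ρV ρJ J₀

end TCM

end Summit.Parity.GeneralizedHardyLittlewood.Cruxes.RelativeDimOne.TypeSplit

end
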